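import Mathlib.Data.Finset.Sups
import Mathlib.Data.Finset.Card
import Mathlib.Data.Fintype.Basic

/-!
# The case `u = univ` of the statement (R*-M)

Dossier proofs/MINE1-theoremS.md, Addendum 37 (F4). The statement (R*-M) concerns a down-set `L'`
of subsets of a finite type (containing every singleton, not containing `univ`), its complement
family `U = {univ ∖ w : w ∈ L'}`, a family `T ⊆ U`, the faces `Y' := {w ∈ L' : w ⊆ y for some
y ∈ T}` with the count `|Y'| ≤ |T| + 1`, the signability condition (Sig) relative to a set `u` and
the existence of an A-only set (AO); its claim is that some member of `T` lies in `L'`. Here the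
case `u = univ` is proved: (Sig) reads «every `v ∈ L'` has `univ ∖ v ∈ L'` or lies below a member»
and (AO) reads «some `v₀ ∈ L'` with `univ ∖ v₀ ∈ L'` lies below no member».

The proof: if no member is in `L'`, (Sig) at `univ ∖ y` puts `univ ∖ y` below a member for every
`y ∈ T`; with `∅` these are `|T| + 1` faces, so they are all the faces, the faces form a down-set,
hence `T ∪ {univ}` is an up-set and every co-singleton `univ ∖ {a}` is a member; then `v₀` lies
below one of them.
-/

namespace PercRepro.MSTight

open Finset

variable {α : Type*} [DecidableEq α] [Fintype α]

/-- The faces of `T` inside `L'`: the members of `L'` lying below some member of `T`. -/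
def faces (L' T : Finset (Finset α)) : Finset (Finset α) :=
  L'.filter fun w => ∃ y ∈ T, w ⊆ y

omit [Fintype α] in
/-- Membership in `faces`. -/
theorem mem_faces {L' T : Finset (Finset α)} {w : Finset α} :
    w ∈ faces L' T ↔ w ∈ L' ∧ ∃ y ∈ T, w ⊆ y := by
  simp [faces]

/-- **(R*-M), the case `u = univ`.** Let `L'` be a down-set of subsets of a finite type containing
every singleton and not containing `univ`, and `T` a nonempty family with `univ ∖ y ∈ L'` for every
member `y`, with at most `|T| + 1` faces, such that every `v ∈ L'` has `univ ∖ v ∈ L'` or lies below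
a member (Sig), while some `v₀ ∈ L'` with `univ ∖ v₀ ∈ L'` lies below no member (AO). Then some
member of `T` lies in `L'`. -/
theorem exists_mem_of_univ {L' T : Finset (Finset α)}
    (hdown : ∀ w ∈ L', ∀ w', w' ⊆ w → w' ∈ L')
    (hsing : ∀ a : α, {a} ∈ L') (hM : (Finset.univ : Finset α) ∉ L')
    (hne : T.Nonempty) (hTU : ∀ y ∈ T, Finset.univ \ y ∈ L')
    (hcnt : (faces L' T).card ≤ T.card + 1)
    (hsig : ∀ v ∈ L', Finset.univ \ v ∈ L' ∨ ∃ y ∈ T, v ⊆ y)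
    (hao : ∃ v₀ ∈ L', Finset.univ \ v₀ ∈ L' ∧ ∀ y ∈ T, ¬ v₀ ⊆ y) :
    ∃ y ∈ T, y ∈ L' := by
  by_contra hcon
  push Not at hcon
  obtain ⟨v₀, hv₀, -, hv₀T⟩ := hao
  -- `univ` is not a member: `v₀` would lie below it.
  have hMT : (Finset.univ : Finset α) ∉ T := fun h => hv₀T _ h (subset_univ _)
  -- every complement of a member lies below a member
  have hcompl : ∀ y ∈ T, ∃ y' ∈ T, Finset.univ \ y ⊆ y' := by
    intro y hy
    rcases hsig _ (hTU y hy) with h | h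
    · rw [sdiff_sdiff_right_self, inf_eq_inter, univ_inter] at h
      exact absurd h (hcon y hy)
    · exact h
  -- the complements of the members, together with `∅`, are faces
  set Φ : Finset (Finset α) := T.image fun y => Finset.univ \ y with hΦ
  have hΦsub : insert ∅ Φ ⊆ faces L' T := by
    intro w hw
    rw [mem_insert] at hw
    rcases hw with rfl | hw
    · obtain ⟨y, hy⟩ := hne
      exact mem_faces.2 ⟨hdown _ (hTU y hy) _ (empty_subset _), y, hy, empty_subset _⟩
    · obtain ⟨y, hy, rfl⟩ := mem_image.1 hw
      exact mem_faces.2 ⟨hTU y hy, hcompl y hy⟩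
  have hΦcard : Φ.card = T.card := by
    rw [hΦ]
    apply card_image_of_injective
    intro y y' h
    have := congrArg (fun s => Finset.univ \ s) h
    simpa using this
  have hemptyΦ : ∅ ∉ Φ := by
    intro h
    obtain ⟨y, hy, hy'⟩ := mem_image.1 h
    have : y = Finset.univ := by
      have h2 := congrArg (fun s => Finset.univ \ s) hy'
      simpa using h2
    exact hMT (this ▸ hy)
  have hcard : (insert ∅ Φ).card = T.card + 1 := by
    rw [card_insert_of_notMem hemptyΦ, hΦcard]
  -- hence these are all the faces
  have hfaces : faces L' T = insert ∅ Φ :=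
    (eq_of_subset_of_card_le hΦsub (hcard ▸ hcnt)).symm
  -- `T ∪ {univ}` is an up-set: adding a point to a member gives a member or `univ`
  have hup : ∀ y ∈ T, ∀ a : α, a ∉ y → insert a y ∈ T ∨ insert a y = Finset.univ := by
    intro y hy a ha
    have h1 : Finset.univ \ insert a y ∈ faces L' T := by
      obtain ⟨y', hy', hsub⟩ := hcompl y hy
      refine mem_faces.2 ⟨hdown _ (hTU y hy) _ (sdiff_subset_sdiff (subset_refl _) (subset_insert _ _)), y', hy', ?_⟩
      exact (sdiff_subset_sdiff (subset_refl _) (subset_insert _ _)).trans hsub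
    rw [hfaces, mem_insert] at h1
    rcases h1 with h1 | h1
    · right
      have := congrArg (fun s => Finset.univ \ s) h1
      simpa using this
    · left
      obtain ⟨y'', hy'', h2⟩ := mem_image.1 h1
      have : y'' = insert a y := by
        have h3 := congrArg (fun s => Finset.univ \ s) h2
        simpa using h3
      exact this ▸ hy''
  -- every point lies in some member
  have hcover : ∀ a : α, ∃ y ∈ T, a ∈ y := by
    intro a
    by_contra hno
    push Not at hno
    obtain ⟨y, hy⟩ := hne
    rcases hup y hy a (hno y hy) with h | h
    · exact hno _ h (mem_insert_self _ _)
    · -- `y = univ ∖ {a}`, which lies in `L'` by (Sig) at `{a}` (the singleton is below no member)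
      have hya : y = Finset.univ \ {a} := by
        rw [← h, insert_eq, union_sdiff_cancel_left]
        exact disjoint_singleton_left.2 (hno y hy)
      have hsa : Finset.univ \ {a} ∈ L' := by
        rcases hsig {a} (hsing a) with h' | ⟨y', hy', hsub⟩
        · exact h'
        · exact absurd (hsub (mem_singleton_self a)) (hno y' hy')
      exact hcon y hy (hya ▸ hsa)
  -- every co-singleton is a member
  have hcosing : ∀ a : α, Finset.univ \ {a} ∈ T := by
    intro a
    obtain ⟨y, hy, hay⟩ := hcover a
    have h1 : ({a} : Finset α) ∈ faces L' T := mem_faces.2 ⟨hsing a, y, hy, singleton_subset_iff.2 hay⟩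
    rw [hfaces, mem_insert] at h1
    rcases h1 with h1 | h1
    · exact absurd h1 (singleton_ne_empty a)
    · obtain ⟨y', hy', h2⟩ := mem_image.1 h1
      have : y' = Finset.univ \ {a} := by
        have h3 := congrArg (fun s => Finset.univ \ s) h2
        simpa using h3
      exact this ▸ hy'
  -- `v₀ ≠ univ` lies below the co-singleton of a point outside it
  have hv₀ne : v₀ ≠ Finset.univ := fun h => hM (h ▸ hv₀)
  obtain ⟨a, ha⟩ : ∃ a, a ∉ v₀ := by
    by_contra hall
    push Not at hall
    exact hv₀ne (eq_univ_iff_forall.2 hall)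
  exact hv₀T _ (hcosing a) (subset_sdiff.2 ⟨subset_univ _, disjoint_singleton_right.2 ha⟩)

end PercRepro.MSTight
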